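import Summits.CriticalPhenomena.PercolationContinuityZ3.Theorems.SahiAEFourFunctionsDiag
import Literature.Probability.LatticeModels.Affiliation
import Mathlib.MeasureTheory.Constructions.Pi

/-!
# The four functions theorem under an ALMOST-EVERYWHERE lattice hypothesis; a.e.-pair MTP₂ densities are set-TP₂

Support file of the Sahi cell (`prim-sahi`, typer seat, generation 19; `--supports stmt-CriticalPhenomena-4575`).
Theorems only (no definitions, no named facts, no sorries).  Part 2 (part 1: the diagonal lemma,
`SahiAEFourFunctionsDiag.lean`).

* `fourFunctions_marginal_ae` — the marginal step of [KarlinRinott1980] Thm. 2.1 for one coordinate of `ℝ^{n+1}`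
  under the a.e.-pair hypothesis for two base points `y, z`: the four pointwise inequalities of the `2 × 2` step
  hold simultaneously for `ν ⊗ ν`-a.e. pair of heights (the given one, its swap — `ν ⊗ ν` is swap-invariant — and
  the two diagonal ones from the diagonal lemma `ae_le_of_ae_pair_le`), so the symmetrised double integral goes
  through with `lintegral_mono_ae`.
* `lintegral_four_functions_fin_ae`, `lintegral_four_functions_ae` — **Thm. 2.1 with the lattice hypothesis for
  `(∏μᵢ) ⊗ (∏μᵢ)`-ALMOST EVERY PAIR only**: σ-finite `μᵢ` on `ℝ`, measurable `fⱼ : ℝ^ι → [0,∞]`,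
  `f₁(x) f₂(y) ≤ f₃(x ∨ y) f₄(x ∧ y)` a.e. `(x,y)` ⟹ `(∫⁻f₁)(∫⁻f₂) ≤ (∫⁻f₃)(∫⁻f₄)`.  The a.e. hypothesis is
  transported through `ℝ^{n+1} ≃ ℝ × ℝⁿ` (`measurePreserving_piFinSuccAbove`, squared), re-associated
  (`measurePreserving_shuffle`) and split by Fubini (`Measure.ae_ae_of_ae_prod`) into "for a.e. pair of base points,
  for a.e. pair of heights", which is what the marginal step consumes; the induction hypothesis is again an a.e.-pair
  statement.
* `mIsSetTP2_withDensity_pi_of_ae`, `mIsAffiliated_withDensity_pi_of_ae` — **[MullerStoyan2002] Thm. 3.10.14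
  (i) ⇒ (ii) ⇒ (iii) and the 'IF' half of [MilgromWeber1982] Theorem 24 in the printed almost-everywhere form**: a
  measurable density with respect to a product of σ-finite measures on `ℝ^ι` which is MTP₂ on ALMOST EVERY PAIR
  defines a set-TP₂ (`mIsSetTP2`), hence affiliated (`mIsAffiliated`), law — no everywhere-MTP₂ version of the
  density is needed.  (The tree's `mIsSetTP2_withDensity_pi` / `mIsAffiliated_withDensity_pi` take the inequality at
  every pair; the converse, a.e.-pair MTP₂ from affiliation, is the tree's
  `Affiliation.ae_pair_latticeCondition_of_mIsAffiliated`.)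

ATTRIBUTION (doc-only v2, cell finding A33-1).  The almost-everywhere four functions theorem on FINITE products of
totally ordered σ-finite measure spaces is in print: [BattyBollmann1980] (Prop. 2.1 = the diagonal lemma, Prop. 3.4 =
the one-dimensional case, Lemma 3.6 = the marginal step, Thm. 3.7 = finite products; p. 159: "(1.13) is always valid
if (1.7) holds `μ²`-a.e."), with the Holley, Preston and FKG inequalities (1.5), (1.6), (1.8) listed there as special
cases of (1.13).  The theorems below are that result on `ℝ^ι` (re-derived before the source surfaced; the proofs
follow Karlin–Rinott's induction with the diagonal lemma supplying the null-set step) and are now tagged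
accordingly.  Batty–Bollmann's Example 2.3 (tree: `Literature/Probability/LatticeModels/FourFunctionsAEInfinite.lean`)
shows the a.e. form FAILS for infinite products, so nothing here should be transported to `[0,1]^ℕ`.

No sorries, no new axioms.
-/

noncomputable section

namespace Summit.CriticalPhenomena.PercolationContinuityZ3.Theorems.SahiAEFourFunctions

open MeasureTheory Set Filter
open Literature.Probability.LatticeModels Literature.Probability.LatticeModels.Affiliation
open scoped ENNReal NNReal SetFamily

/-! ### The marginal step under the a.e.-pair hypothesis (one coordinate of `ℝ^{n+1}`) -/

section Marginal

variable {n : ℕ}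

/-- `insertNth` commutes with the coordinatewise `⊔` (non-dependent real tuples). [folklore] -/
private theorem insertNth_sup (i : Fin (n + 1)) (t s : ℝ) (y z : Fin n → ℝ) :
    (Fin.insertNth (α := fun _ => ℝ) i t y) ⊔ (Fin.insertNth (α := fun _ => ℝ) i s z) =
      Fin.insertNth (α := fun _ => ℝ) i (t ⊔ s) (y ⊔ z) := by
  have h := Fin.insertNth_binop (α := fun _ => ℝ) (fun _ a b => a ⊔ b) i t s y z
  have e : (Fin.insertNth (α := fun _ => ℝ) i t y) ⊔ (Fin.insertNth (α := fun _ => ℝ) i s z) =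
      fun j => (Fin.insertNth (α := fun _ => ℝ) i t y j) ⊔ (Fin.insertNth (α := fun _ => ℝ) i s z j) :=
    rfl
  rw [e, ← h]
  rfl

/-- `insertNth` commutes with the coordinatewise `⊓` (non-dependent real tuples). [folklore] -/
private theorem insertNth_inf (i : Fin (n + 1)) (t s : ℝ) (y z : Fin n → ℝ) :
    (Fin.insertNth (α := fun _ => ℝ) i t y) ⊓ (Fin.insertNth (α := fun _ => ℝ) i s z) =
      Fin.insertNth (α := fun _ => ℝ) i (t ⊓ s) (y ⊓ z) := by
  have h := Fin.insertNth_binop (α := fun _ => ℝ) (fun _ a b => a ⊓ b) i t s y z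
  have e : (Fin.insertNth (α := fun _ => ℝ) i t y) ⊓ (Fin.insertNth (α := fun _ => ℝ) i s z) =
      fun j => (Fin.insertNth (α := fun _ => ℝ) i t y j) ⊓ (Fin.insertNth (α := fun _ => ℝ) i s z j) :=
    rfl
  rw [e, ← h]
  rfl

/-- Sections of a measurable function on `ℝ^{n+1}` along `insertNth` are jointly measurable in `(t, y)`.
[folklore] -/
private theorem measurable_comp_insertNth {g : (Fin (n + 1) → ℝ) → ℝ≥0∞} (hg : Measurable g)
    (i : Fin (n + 1)) : Measurable fun p : ℝ × (Fin n → ℝ) => g (Fin.insertNth i p.1 p.2) := by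
  have hm : Measurable fun p : ℝ × (Fin n → ℝ) =>
      (MeasurableEquiv.piFinSuccAbove (fun _ => ℝ) i).symm p :=
    (MeasurableEquiv.piFinSuccAbove (fun _ => ℝ) i).symm.measurable
  have e : (fun p : ℝ × (Fin n → ℝ) => g (Fin.insertNth i p.1 p.2)) =
      fun p => g ((MeasurableEquiv.piFinSuccAbove (fun _ => ℝ) i).symm p) := by
    funext p
    simp [MeasurableEquiv.piFinSuccAbove_symm_apply, Fin.insertNthEquiv]
  rw [e]
  exact hg.comp hm

/-- The Lebesgue marginal `y ↦ ∫⁻ g(xᵢ := t, y) dν(t)` of a measurable `g` is measurable. [folklore] -/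
private theorem measurable_lmarginal (ν : Measure ℝ) [SFinite ν]
    {g : (Fin (n + 1) → ℝ) → ℝ≥0∞} (hg : Measurable g) (i : Fin (n + 1)) :
    Measurable fun y : Fin n → ℝ => ∫⁻ t, g (Fin.insertNth i t y) ∂ν :=
  (measurable_comp_insertNth hg i).lintegral_prod_left'

variable {f₁ f₂ f₃ f₄ : (Fin (n + 1) → ℝ) → ℝ≥0∞}

/-- **The marginal step of Thm. 2.1 under the a.e.-pair hypothesis**: if, for two base points `y, z ∈ ℝⁿ`,
`f₁(t,y) f₂(s,z) ≤ f₃((t,y) ∨ (s,z)) f₄((t,y) ∧ (s,z))` holds for `ν ⊗ ν`-ALMOST EVERY pair of heights `(t, s)`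
(coordinate `i`), then the Lebesgue marginals satisfy
`(∫ f₁(·,y))(∫ f₂(·,z)) ≤ (∫ f₃(·,y ∨ z))(∫ f₄(·,y ∧ z))`.  The symmetrised double integral of Karlin–Rinott with
the integrand inequality available a.e.: the given pair, its swap (`ν ⊗ ν` is swap-invariant) and the two diagonal
inequalities supplied by `ae_le_of_ae_pair_le`.  (Batty–Bollmann's Lemma 3.6, `μ`-compatible case, for one real
coordinate.) [cite: BattyBollmann1980, Lemma 3.6] -/
theorem fourFunctions_marginal_ae (ν : Measure ℝ) [SFinite ν] (hm₁ : Measurable f₁) (hm₂ : Measurable f₂)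
    (hm₃ : Measurable f₃) (hm₄ : Measurable f₄) (i : Fin (n + 1)) (y z : Fin n → ℝ)
    (h : ∀ᵐ r ∂ν.prod ν, f₁ (Fin.insertNth i r.1 y) * f₂ (Fin.insertNth i r.2 z) ≤
      f₃ (Fin.insertNth i r.1 y ⊔ Fin.insertNth i r.2 z) * f₄ (Fin.insertNth i r.1 y ⊓ Fin.insertNth i r.2 z)) :
    (∫⁻ t, f₁ (Fin.insertNth i t y) ∂ν) * (∫⁻ t, f₂ (Fin.insertNth i t z) ∂ν) ≤
      (∫⁻ t, f₃ (Fin.insertNth i t (y ⊔ z)) ∂ν) * (∫⁻ t, f₄ (Fin.insertNth i t (y ⊓ z)) ∂ν) := by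
  have sec : ∀ {g : (Fin (n + 1) → ℝ) → ℝ≥0∞}, Measurable g → ∀ w : Fin n → ℝ,
      Measurable fun t : ℝ => g (Fin.insertNth i t w) :=
    fun hg w => (measurable_comp_insertNth hg i).comp (measurable_id.prodMk measurable_const)
  set F₁ : ℝ → ℝ≥0∞ := fun t => f₁ (Fin.insertNth i t y) with hF₁
  set F₂ : ℝ → ℝ≥0∞ := fun t => f₂ (Fin.insertNth i t z) with hF₂
  set F₃ : ℝ → ℝ≥0∞ := fun t => f₃ (Fin.insertNth i t (y ⊔ z)) with hF₃
  set F₄ : ℝ → ℝ≥0∞ := fun t => f₄ (Fin.insertNth i t (y ⊓ z)) with hF₄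
  have mF₁ : Measurable F₁ := sec hm₁ y
  have mF₂ : Measurable F₂ := sec hm₂ z
  have mF₃ : Measurable F₃ := sec hm₃ _
  have mF₄ : Measurable F₄ := sec hm₄ _
  -- the four a.e. inequalities
  have h' : ∀ᵐ r ∂ν.prod ν, F₁ r.1 * F₂ r.2 ≤ F₃ (r.1 ⊔ r.2) * F₄ (r.1 ⊓ r.2) := by
    filter_upwards [h] with r hr
    rwa [insertNth_sup, insertNth_inf] at hr
  have hd : ∀ᵐ t ∂ν, F₁ t * F₂ t ≤ F₃ t * F₄ t := ae_le_of_ae_pair_le ν F₁ F₂ F₃ F₄ h'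
  have hsw : ∀ᵐ r ∂ν.prod ν, F₁ r.2 * F₂ r.1 ≤ F₃ (r.2 ⊔ r.1) * F₄ (r.2 ⊓ r.1) :=
    (Measure.measurePreserving_swap (μ := ν) (ν := ν)).quasiMeasurePreserving.ae h'
  have hd₁ : ∀ᵐ r ∂ν.prod ν, F₁ r.1 * F₂ r.1 ≤ F₃ r.1 * F₄ r.1 :=
    (Measure.quasiMeasurePreserving_fst (μ := ν) (ν := ν)).ae hd
  have hd₂ : ∀ᵐ r ∂ν.prod ν, F₁ r.2 * F₂ r.2 ≤ F₃ r.2 * F₄ r.2 :=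
    (Measure.quasiMeasurePreserving_snd (μ := ν) (ν := ν)).ae hd
  -- product integrals and their swapped forms
  have hprod : ∀ {G H : ℝ → ℝ≥0∞}, Measurable G → Measurable H →
      (∫⁻ t, G t ∂ν) * (∫⁻ t, H t ∂ν) = ∫⁻ p : ℝ × ℝ, G p.1 * H p.2 ∂ν.prod ν :=
    fun hG hH => (lintegral_prod_mul hG.aemeasurable hH.aemeasurable).symm
  have hswap : ∀ (G H : ℝ → ℝ≥0∞),
      ∫⁻ p : ℝ × ℝ, G p.2 * H p.1 ∂ν.prod ν = ∫⁻ p : ℝ × ℝ, G p.1 * H p.2 ∂ν.prod ν := by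
    intro G H
    have := lintegral_prod_swap (μ := ν) (ν := ν) (fun p : ℝ × ℝ => G p.1 * H p.2)
    simpa using this
  have m12 : Measurable fun p : ℝ × ℝ => F₁ p.1 * F₂ p.2 :=
    (mF₁.comp measurable_fst).mul (mF₂.comp measurable_snd)
  have m34 : Measurable fun p : ℝ × ℝ => F₃ p.1 * F₄ p.2 :=
    (mF₃.comp measurable_fst).mul (mF₄.comp measurable_snd)
  have lhs : 2 * ((∫⁻ t, F₁ t ∂ν) * (∫⁻ t, F₂ t ∂ν)) =
      ∫⁻ p : ℝ × ℝ, (F₁ p.1 * F₂ p.2 + F₁ p.2 * F₂ p.1) ∂ν.prod ν := by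
    rw [lintegral_add_left m12, hswap, ← hprod mF₁ mF₂, two_mul]
  have rhs : 2 * ((∫⁻ t, F₃ t ∂ν) * (∫⁻ t, F₄ t ∂ν)) =
      ∫⁻ p : ℝ × ℝ, (F₃ p.1 * F₄ p.2 + F₃ p.2 * F₄ p.1) ∂ν.prod ν := by
    rw [lintegral_add_left m34, hswap, ← hprod mF₃ mF₄, two_mul]
  have hmono : ∫⁻ p : ℝ × ℝ, (F₁ p.1 * F₂ p.2 + F₁ p.2 * F₂ p.1) ∂ν.prod ν ≤
      ∫⁻ p : ℝ × ℝ, (F₃ p.1 * F₄ p.2 + F₃ p.2 * F₄ p.1) ∂ν.prod ν := by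
    refine lintegral_mono_ae ?_
    filter_upwards [h', hsw, hd₁, hd₂] with p k₁ k₂ k₃ k₄
    exact add_le_add_of_pair_of_diag k₁ k₂ k₃ k₄
  have key : 2 * ((∫⁻ t, F₁ t ∂ν) * (∫⁻ t, F₂ t ∂ν)) ≤ 2 * ((∫⁻ t, F₃ t ∂ν) * (∫⁻ t, F₄ t ∂ν)) := by
    rw [lhs, rhs]; exact hmono
  exact (ENNReal.mul_le_mul_iff_right two_ne_zero ENNReal.ofNat_ne_top).1 key

end Marginal

/-! ### Thm. 2.1 under the a.e.-pair hypothesis -/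

/-- **Karlin–Rinott's four functions theorem on `ℝⁿ` under the ALMOST-EVERYWHERE lattice hypothesis**: for σ-finite
`μ₀,…,μ_{n−1}` on `ℝ` and measurable `f₁, f₂, f₃, f₄ : ℝⁿ → [0,∞]` with `f₁(x) f₂(y) ≤ f₃(x ∨ y) f₄(x ∧ y)` for
`(∏μᵢ) ⊗ (∏μᵢ)`-ALMOST EVERY `(x, y)`, `(∫⁻ f₁)(∫⁻ f₂) ≤ (∫⁻ f₃)(∫⁻ f₄)`.  Induction on `n`: the a.e. hypothesis
is transported to `(ℝ × ℝ^{n}) × (ℝ × ℝ^{n})`, re-associated, and split by Fubini into "for a.e. pair of base points,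
for a.e. pair of heights", which is what `fourFunctions_marginal_ae` consumes.  (Batty–Bollmann's Thm. 3.7 with
Prop. 3.4 — strong 𝔐-expansiveness of finite products of totally ordered σ-finite measure spaces — on `ℝⁿ`; the
proof route differs.) [cite: BattyBollmann1980, Thm. 3.7] -/
theorem lintegral_four_functions_fin_ae :
    ∀ (n : ℕ) (μ : Fin n → Measure ℝ) [∀ i, SigmaFinite (μ i)] (f₁ f₂ f₃ f₄ : (Fin n → ℝ) → ℝ≥0∞),
      Measurable f₁ → Measurable f₂ → Measurable f₃ → Measurable f₄ →
      (∀ᵐ p ∂(Measure.pi μ).prod (Measure.pi μ), f₁ p.1 * f₂ p.2 ≤ f₃ (p.1 ⊔ p.2) * f₄ (p.1 ⊓ p.2)) →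
        (∫⁻ x, f₁ x ∂Measure.pi μ) * (∫⁻ x, f₂ x ∂Measure.pi μ) ≤
          (∫⁻ x, f₃ x ∂Measure.pi μ) * (∫⁻ x, f₄ x ∂Measure.pi μ)
  | 0, μ, _, f₁, f₂, f₃, f₄, hm₁, hm₂, hm₃, hm₄, h => by
    let x₀ : Fin 0 → ℝ := isEmptyElim
    have hpt : f₁ x₀ * f₂ x₀ ≤ f₃ (x₀ ⊔ x₀) * f₄ (x₀ ⊓ x₀) := by
      rw [Measure.pi_of_empty μ x₀, Measure.dirac_prod_dirac, ae_dirac_eq, eventually_pure] at h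
      exact h
    rw [Measure.pi_of_empty μ x₀, lintegral_dirac' _ hm₁, lintegral_dirac' _ hm₂,
      lintegral_dirac' _ hm₃, lintegral_dirac' _ hm₄]
    simpa using hpt
  | n + 1, μ, _, f₁, f₂, f₃, f₄, hm₁, hm₂, hm₃, hm₄, h => by
    set ν := μ 0 with hν
    set μ' : Fin n → Measure ℝ := fun j => μ (Fin.succAbove 0 j) with hμ'
    have hmp := measurePreserving_piFinSuccAbove μ 0
    have split : ∀ {g : (Fin (n + 1) → ℝ) → ℝ≥0∞}, Measurable g →
        ∫⁻ x, g x ∂Measure.pi μ = ∫⁻ y, (∫⁻ t, g (Fin.insertNth 0 t y) ∂ν) ∂Measure.pi μ' := by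
      intro g hg
      have h1 := hmp.symm _ |>.lintegral_comp_emb
        (MeasurableEquiv.piFinSuccAbove (fun _ => ℝ) 0).symm.measurableEmbedding g
      rw [← h1]
      have e : (fun p : ℝ × (Fin n → ℝ) => g ((MeasurableEquiv.piFinSuccAbove (fun _ => ℝ) 0).symm p))
          = fun p => g (Fin.insertNth 0 p.1 p.2) := by
        funext p
        simp [MeasurableEquiv.piFinSuccAbove_symm_apply, Fin.insertNthEquiv]
      rw [e, lintegral_prod_symm _ (measurable_comp_insertNth hg 0).aemeasurable]
    rw [split hm₁, split hm₂, split hm₃, split hm₄]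
    -- transport of the a.e.-pair hypothesis: for a.e. pair of base points, for a.e. pair of heights
    have h2 : ∀ᵐ q ∂(Measure.pi μ').prod (Measure.pi μ'), ∀ᵐ r ∂ν.prod ν,
        f₁ (Fin.insertNth 0 r.1 q.1) * f₂ (Fin.insertNth 0 r.2 q.2) ≤
          f₃ (Fin.insertNth 0 r.1 q.1 ⊔ Fin.insertNth 0 r.2 q.2) *
            f₄ (Fin.insertNth 0 r.1 q.1 ⊓ Fin.insertNth 0 r.2 q.2) := by
      set e := MeasurableEquiv.piFinSuccAbove (fun _ : Fin (n + 1) => ℝ) 0 with he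
      have hsymm : MeasurePreserving e.symm (ν.prod (Measure.pi μ')) (Measure.pi μ) := hmp.symm _
      have h3 := (hsymm.prod hsymm).quasiMeasurePreserving.ae h
      have h4 := (measurePreserving_shuffle (Measure.pi μ') (Measure.pi μ') ν ν).quasiMeasurePreserving.ae h3
      have h5 := Measure.ae_ae_of_ae_prod h4
      filter_upwards [h5] with q hq
      filter_upwards [hq] with r hr
      simpa [he, MeasurableEquiv.piFinSuccAbove_symm_apply, Fin.insertNthEquiv, Prod.map] using hr
    refine lintegral_four_functions_fin_ae n μ' _ _ _ _ (measurable_lmarginal ν hm₁ 0)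
      (measurable_lmarginal ν hm₂ 0) (measurable_lmarginal ν hm₃ 0) (measurable_lmarginal ν hm₄ 0) ?_
    filter_upwards [h2] with q hq
    exact fourFunctions_marginal_ae ν hm₁ hm₂ hm₃ hm₄ 0 q.1 q.2 hq

/-- A coordinate relabelling `ℝ^ι ≃ ℝ^{ι'}` commutes with the coordinatewise `⊔`. [folklore] -/
private theorem piCongrLeft_sup {ι ι' : Type*} (e : ι' ≃ ι) (x y : ι' → ℝ) :
    MeasurableEquiv.piCongrLeft (fun _ => ℝ) e (x ⊔ y) =
      MeasurableEquiv.piCongrLeft (fun _ => ℝ) e x ⊔ MeasurableEquiv.piCongrLeft (fun _ => ℝ) e y := by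
  funext b
  simp only [MeasurableEquiv.coe_piCongrLeft, Equiv.piCongrLeft_apply_eq_cast, cast_eq, Pi.sup_apply]

/-- As `piCongrLeft_sup`, for `⊓`. [folklore] -/
private theorem piCongrLeft_inf {ι ι' : Type*} (e : ι' ≃ ι) (x y : ι' → ℝ) :
    MeasurableEquiv.piCongrLeft (fun _ => ℝ) e (x ⊓ y) =
      MeasurableEquiv.piCongrLeft (fun _ => ℝ) e x ⊓ MeasurableEquiv.piCongrLeft (fun _ => ℝ) e y := by
  funext b
  simp only [MeasurableEquiv.coe_piCongrLeft, Equiv.piCongrLeft_apply_eq_cast, cast_eq, Pi.inf_apply]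

/-- **The four functions theorem under the a.e.-pair hypothesis, general finite index type**
(relabelling `ι ≃ Fin n`). [cite: BattyBollmann1980, Thm. 3.7] -/
theorem lintegral_four_functions_ae {ι : Type*} [Fintype ι] (μ : ι → Measure ℝ)
    [∀ i, SigmaFinite (μ i)] (f₁ f₂ f₃ f₄ : (ι → ℝ) → ℝ≥0∞) (hm₁ : Measurable f₁)
    (hm₂ : Measurable f₂) (hm₃ : Measurable f₃) (hm₄ : Measurable f₄)
    (h : ∀ᵐ p ∂(Measure.pi μ).prod (Measure.pi μ), f₁ p.1 * f₂ p.2 ≤ f₃ (p.1 ⊔ p.2) * f₄ (p.1 ⊓ p.2)) :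
    (∫⁻ x, f₁ x ∂Measure.pi μ) * (∫⁻ x, f₂ x ∂Measure.pi μ) ≤
      (∫⁻ x, f₃ x ∂Measure.pi μ) * (∫⁻ x, f₄ x ∂Measure.pi μ) := by
  classical
  set e := (Fintype.equivFin ι).symm with he
  set E := MeasurableEquiv.piCongrLeft (fun _ => ℝ) e with hE
  have hmp : MeasurePreserving E (Measure.pi fun k => μ (e k)) (Measure.pi μ) :=
    measurePreserving_piCongrLeft μ e
  have tr : ∀ g : (ι → ℝ) → ℝ≥0∞, ∫⁻ x, g x ∂Measure.pi μ = ∫⁻ a, g (E a) ∂Measure.pi fun k => μ (e k) :=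
    fun g => (hmp.lintegral_comp_emb E.measurableEmbedding g).symm
  rw [tr f₁, tr f₂, tr f₃, tr f₄]
  have h' : ∀ᵐ p ∂(Measure.pi fun k => μ (e k)).prod (Measure.pi fun k => μ (e k)),
      f₁ (E p.1) * f₂ (E p.2) ≤ f₃ (E (p.1 ⊔ p.2)) * f₄ (E (p.1 ⊓ p.2)) := by
    filter_upwards [(hmp.prod hmp).quasiMeasurePreserving.ae h] with p hp
    rw [piCongrLeft_sup, piCongrLeft_inf]
    simpa [Prod.map] using hp
  exact lintegral_four_functions_fin_ae (Fintype.card ι) (fun k => μ (e k)) (fun a => f₁ (E a))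
    (fun a => f₂ (E a)) (fun a => f₃ (E a)) (fun a => f₄ (E a)) (hm₁.comp E.measurable)
    (hm₂.comp E.measurable) (hm₃.comp E.measurable) (hm₄.comp E.measurable) h'

/-! ### MTP₂ on almost every pair ⟹ set-TP₂ ⟹ affiliated -/

/-- **Müller–Stoyan 3.10.14 (i) ⇒ (ii) / Milgrom–Weber Thm. 24 'if', almost-everywhere form**: a law on `ℝ^ι` with a
measurable density `f` with respect to a product of σ-finite measures which is MTP₂ on ALMOST EVERY PAIR
(`f(x) f(y) ≤ f(x ∧ y) f(x ∨ y)` for `(∏μᵢ) ⊗ (∏μᵢ)`-a.e. `(x,y)`) is set-TP₂: `ν(A) ν(B) ≤ ν(A ∧ B) ν(A ∨ B)` for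
all measurable `A, B`.  (`lintegral_four_functions_ae` with `f·1_A, f·1_B` and measurable hulls of `A ∨ B`,
`A ∧ B`, exactly as the tree's everywhere version `mIsSetTP2_withDensity_pi`; Batty–Bollmann's (3.3) with
Remark 3.1(d) for the `μ`-compatible quadruple `(f, f, f, f)`.) [cite: BattyBollmann1980, Thm. 3.7 with Remark 3.1(d)]
[cite: MullerStoyan2002, Thm. 3.10.14 (i) ⇒ (ii)] -/
theorem mIsSetTP2_withDensity_pi_of_ae {ι : Type*} [Fintype ι] (μ : ι → Measure ℝ) [∀ i, SigmaFinite (μ i)]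
    (f : (ι → ℝ) → ℝ≥0∞) (hf : Measurable f)
    (hMTP : ∀ᵐ p ∂(Measure.pi μ).prod (Measure.pi μ), f p.1 * f p.2 ≤ f (p.1 ⊓ p.2) * f (p.1 ⊔ p.2)) :
    mIsSetTP2 ((Measure.pi μ).withDensity f) := by
  intro A B hA hB
  set P := Measure.pi μ with hP
  set ν := P.withDensity f with hν
  set T₃ := toMeasurable ν (A ⊻ B) with hT₃
  set T₄ := toMeasurable ν (A ⊼ B) with hT₄
  have mT₃ : MeasurableSet T₃ := measurableSet_toMeasurable _ _
  have mT₄ : MeasurableSet T₄ := measurableSet_toMeasurable _ _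
  have AD := lintegral_four_functions_ae μ (A.indicator f) (B.indicator f) (T₃.indicator f) (T₄.indicator f)
    (hf.indicator hA) (hf.indicator hB) (hf.indicator mT₃) (hf.indicator mT₄) (by
      filter_upwards [hMTP] with p hp
      by_cases hx : p.1 ∈ A
      · by_cases hy : p.2 ∈ B
        · have h3 : p.1 ⊔ p.2 ∈ T₃ := subset_toMeasurable _ _ (Set.sup_mem_sups hx hy)
          have h4 : p.1 ⊓ p.2 ∈ T₄ := subset_toMeasurable _ _ (Set.inf_mem_infs hx hy)
          rw [Set.indicator_of_mem hx, Set.indicator_of_mem hy, Set.indicator_of_mem h3,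
            Set.indicator_of_mem h4, mul_comm (f (p.1 ⊔ p.2))]
          exact hp
        · rw [Set.indicator_of_notMem hy, mul_zero]
          exact zero_le
      · rw [Set.indicator_of_notMem hx, zero_mul]
        exact zero_le)
  rw [lintegral_indicator hA, lintegral_indicator hB, lintegral_indicator mT₃, lintegral_indicator mT₄,
    ← withDensity_apply f hA, ← withDensity_apply f hB, ← withDensity_apply f mT₃,
    ← withDensity_apply f mT₄] at AD
  rw [← hν, hT₃, hT₄, measure_toMeasurable, measure_toMeasurable] at AD
  calc ν A * ν B ≤ ν (A ⊻ B) * ν (A ⊼ B) := AD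
    _ = ν (A ⊼ B) * ν (A ⊻ B) := mul_comm _ _

/-- **(i)-a.e. ⇒ (iii)**: an a.e.-pair MTP₂ density with respect to a product of σ-finite measures on `ℝ^ι` defines an
affiliated law (Milgrom–Weber's Theorem 24, 'if' half, in its printed almost-everywhere form, for any product
reference measure). [cite: MilgromWeber1982, Thm. 24 ('if' half, printed a.e. form)] -/
theorem mIsAffiliated_withDensity_pi_of_ae {ι : Type*} [Fintype ι] (μ : ι → Measure ℝ) [∀ i, SigmaFinite (μ i)]
    (f : (ι → ℝ) → ℝ≥0∞) (hf : Measurable f)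
    (hMTP : ∀ᵐ p ∂(Measure.pi μ).prod (Measure.pi μ), f p.1 * f p.2 ≤ f (p.1 ⊓ p.2) * f (p.1 ⊔ p.2)) :
    mIsAffiliated ((Measure.pi μ).withDensity f) :=
  (mIsSetTP2_withDensity_pi_of_ae μ f hf hMTP).mIsAffiliated

end Summit.CriticalPhenomena.PercolationContinuityZ3.Theorems.SahiAEFourFunctions
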